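import Mathlib.RingTheory.AlgebraicIndependent.TranscendenceBasis
import Mathlib.LinearAlgebra.FiniteDimensional.Lemmas
import Mathlib.LinearAlgebra.Dimension.Constructions
import Literature.NumberTheory.Transcendental.EclPregeometry
import Literature.NumberTheory.Transcendental.KirbyWeakSchanuelAx
import Literature.NumberTheory.Transcendental.AxSchanuelUniv
import HarnessLib

/-!
# Kirby's weak Schanuel property holds in every exponential field (discharge of `Kirby2010_weakSchanuel`)

Trunk T-TRANSCEND (`Literature/NumberTheory/Transcendental`). Proofs file for the named fact
`Literature.NumberTheory.Transcendental.Kirby2010_weakSchanuel K` of `EclPregeometry.lean`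
(J. Kirby, *Exponential algebraicity in exponential fields*, Bull. Lond. Math. Soc. 42 (2010),
879–890, Thm. 1.2 in the form `δ(x̄/C) ≥ 0`: for every `ecl`-closed `C ⊆ K` and every `x̄ ∈ Kⁿ`,
`ldim_ℚ(x̄/C) ≤ td(x̄, exp x̄/C)`), which this file DISCHARGES for exponential fields `K : Type u` in
every universe: `Kirby2010_weakSchanuel_holds`.

`KirbyWeakSchanuelAx.lean` proves the fact for fields `K : Type` (`Kirby2010_weakSchanuel_holds_type0`):
its main step `le_relTrdeg_of_isEclClosed` takes Ax's theorem as the hypothesis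
`hAx : Transcendental.ax_schanuel`, a named fact quantifying over `K : Type`, and applies it to the
subfield `L = ℚ(C)(x̄, e^{x̄})` of `K`, which pins `K` to `Type`. Ax's theorem is now available in
every universe (`Ax1971.add_rank_le_trdeg`, `AxSchanuelUniv.lean`, from the polymorphic
`Rosenlicht.Rosenlicht1976_prop4_mp`), so we re-run Kirby's induction verbatim with that theorem in
place of `hAx` (`card_le_relTrdeg_of_isEclClosed`) and conclude. The mathematical route is the one
documented in `KirbyWeakSchanuelAx.lean` (Kirby 2010, proof of Thm. 1.2 read inside the finitely
generated field `L`, p. 11, with Lemma 4.8 / Prop. 7.1 as the Khovanskii dichotomy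
`khovanskii_dichotomy` and Thm. 5.1 = Ax 1971 Thm. 3 with one derivation):

* if `(x̄, e^{x̄})` solves a Khovanskii system over `C` then `x₁ ∈ ecl C = C`, contradicting the
  linear independence of `x̄` modulo `C`;
* otherwise a non-zero E-derivation `∂` of `L` over `C` with constants `E` splits `n = m + n'`,
  `m = dim {q ∈ ℚⁿ | q·x̄ ∈ E} < n`; an integral basis of that space gives `z̄ ∈ Eᵐ` with
  `e^{z̄} ∈ Eᵐ`, independent modulo `C`, so `m ≤ td(z̄, e^{z̄}/C) ≤ trdeg_C E` by induction; a
  maximal sub-tuple of `x̄` independent modulo `E` has `n'` elements and Ax's theorem for `(L, ∂)`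
  gives `n' ≤ trdeg_E L`; the tower law `trdeg_C E + trdeg_E L ≤ trdeg_C L` concludes.

## Contents (all proved)

* `card_le_relTrdeg_of_isEclClosed` — Kirby 2010 Thm. 1.2 / Cor. 5.2 for `ecl`-closed `C` and `x̄`
  independent modulo `C`: `n ≤ td(x̄, exp x̄/C)`, unconditionally, any universe.
* `Kirby2010_weakSchanuel_holds` — **the named fact `Kirby2010_weakSchanuel K` HOLDS** for every
  exponential field `K` of characteristic zero (any universe).

## References

* J. Kirby, *Exponential algebraicity in exponential fields*, Bull. Lond. Math. Soc. 42 (2010),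
  879–890, arXiv:0810.4285: Thm. 1.2, Lemma 3.3, Lemma 4.8, Thm. 5.1, Cor. 5.2, Prop. 7.1, p. 11.
* J. Ax, *On Schanuel's conjectures*, Ann. of Math. 93 (1971), 252–268, Thm. 3.
-/

noncomputable section

open Cardinal MvPolynomial

universe u

namespace Literature.NumberTheory.Transcendental

/-! ### Kirby's Theorem 1.2 for tuples independent modulo an `ecl`-closed set, any universe -/

section Main

-- one long elementary induction step (Kirby's proof of Thm. 1.2 inside `C(x̄, e^{x̄})`), verbatim
-- the proof of `le_relTrdeg_of_isEclClosed` with Ax's theorem `Ax1971.add_rank_le_trdeg` for `hAx`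
set_option maxHeartbeats 400000 in
/-- **Kirby 2010, Thm. 1.2 (form `δ(x̄/C) ≥ 0`) for tuples independent modulo `C`, in every
universe, unconditionally.** If `C ⊆ K` is `ecl`-closed and `x : Fin n → K` is `ℚ`-linearly
independent modulo `⟨C⟩_ℚ`, then `n ≤ td(x̄, exp x̄ / C)`. Strong induction on `n` inside
`L = ℚ(C)(x̄, e^{x̄})` via the Khovanskii dichotomy (Kirby Lemma 4.8 / Prop. 7.1): a Khovanskii
system would put `x₁` in `ecl C = C`; otherwise a non-zero E-derivation `∂` of `L` over `C` with
constants `E` splits `n = m + n'` with `m ≤ trdeg_C E` (induction, through an integral basis of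
`{q | q·x̄ ∈ E}`) and `n' ≤ trdeg_E L` (Ax 1971 Thm. 3 = Kirby Thm. 5.1 for `(L, ∂)`,
`Ax1971.add_rank_le_trdeg`, rank term dropped), and the tower law concludes. This is
`le_relTrdeg_of_isEclClosed` (`KirbyWeakSchanuelAx.lean`, fields in `Type`, hypothesis
`ax_schanuel`) made unconditional and universe-polymorphic. [cite: Kirby2010, Thm. 1.2 and Cor. 5.2] -/
theorem card_le_relTrdeg_of_isEclClosed {K : Type u} [Field K] [CharZero K]
    [Literature.ModelTheory.ExponentialFields.ExponentialRing K] {C : Set K} (hC : IsEclClosed C) :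
    ∀ (n : ℕ) (x : Fin n → K), LinearIndependent ℚ ((Submodule.span ℚ C).mkQ ∘ x) →
      (n : Cardinal) ≤ relTrdeg C x := by
  intro n
  induction n using Nat.strong_induction_on with
  | _ n ih =>
  intro x hx
  classical
  rcases Nat.eq_zero_or_pos n with rfl | hn
  · simp
  -- the base field `F = ℚ(C)` (`= C`) and the field `L = F(x̄, e^{x̄})`
  set F : IntermediateField ℚ K := IntermediateField.adjoin ℚ C with hF
  have hFC : ∀ c : F, (c : K) ∈ C := fun c => adjoin_rat_le_of_isEclClosed hC c.2
  set S : Set K := Set.range x ∪ Set.range (Literature.ModelTheory.ExponentialFields.ExponentialRing.exp ∘ x) with hS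
  set L : IntermediateField F K := IntermediateField.adjoin F S with hL
  change (n : Cardinal) ≤ Algebra.trdeg F L
  have hxS : ∀ i, x i ∈ L := fun i => IntermediateField.subset_adjoin F S (Or.inl ⟨i, rfl⟩)
  have hyS : ∀ i, Literature.ModelTheory.ExponentialFields.ExponentialRing.exp (x i) ∈ L := fun i =>
    IntermediateField.subset_adjoin F S (Or.inr ⟨i, rfl⟩)
  set xL : Fin n → L := fun i => ⟨x i, hxS i⟩ with hxL
  set yL : Fin n → L := fun i => ⟨Literature.ModelTheory.ExponentialFields.ExponentialRing.exp (x i), hyS i⟩ with hyL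
  have hy0 : ∀ i, yL i ≠ 0 := fun i h =>
    (Literature.ModelTheory.ExponentialFields.ExponentialRing.isUnit_exp (x i)).ne_zero (congrArg Subtype.val h)
  have htopL : IntermediateField.adjoin F (Set.range xL ∪ Set.range yL) = ⊤ := by
    have h := IntermediateField.adjoin_preimage_val_eq_top (F := F) S
    have hpre : Set.range xL ∪ Set.range yL = ((↑) : L → K) ⁻¹' S := by
      ext t
      simp only [Set.mem_union, Set.mem_range, Set.mem_preimage, hS, Function.comp_apply]
      constructor
      · rintro (⟨i, rfl⟩ | ⟨i, rfl⟩)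
        · exact Or.inl ⟨i, rfl⟩
        · exact Or.inr ⟨i, rfl⟩
      · rintro (⟨i, hi⟩ | ⟨i, hi⟩)
        · exact Or.inl ⟨i, Subtype.ext hi⟩
        · exact Or.inr ⟨i, Subtype.ext hi⟩
    rw [hpre]
    exact h
  set zL : Fin n ⊕ Fin n → L := Sum.elim xL yL with hzL
  rcases khovanskii_dichotomy xL yL htopL with ⟨g, hg0, hdet⟩ | ⟨D, hDE, j₀, hj₀⟩
  · /- (a) `x̄` solves a Khovanskii system over `C`: impossible -/
    exfalso
    simp only [← hzL] at hg0 hdet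
    have hkpt : Khovanskii.kpt x = algebraMap L K ∘ zL := by
      funext s; rcases s with i | i <;> rfl
    have heval : ∀ p : MvPolynomial (Fin n ⊕ Fin n) F,
        MvPolynomial.eval (Khovanskii.kpt x) (MvPolynomial.map (algebraMap F K) p) =
          algebraMap L K (aeval zL p) := by
      intro p
      rw [MvPolynomial.eval_map, ← MvPolynomial.aeval_def, hkpt, MvPolynomial.aeval_algebraMap_apply]
    set f : Fin n → MvPolynomial (Fin n ⊕ Fin n) K := fun i => MvPolynomial.map (algebraMap F K) (g i)
      with hf
    have hsol : Khovanskii.IsSol C x f :=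
      { coeff := fun i => Khovanskii.mem_polyOver_iff.mpr fun mo => by
          simp only [hf, MvPolynomial.coeff_map]
          exact Subring.subset_closure (hFC _)
        eval_eq := fun i => by
          simp only [hf]
          rw [heval, hg0 i, map_zero]
        det_ne := by
          have hJ : Khovanskii.kjac x f =
              (algebraMap L K).mapMatrix (Matrix.of fun i j => aeval zL (Khovanskii.ePD j (g i))) := by
            ext i j
            simp only [Khovanskii.kjac, Matrix.of_apply, RingHom.mapMatrix_apply, Matrix.map_apply, hf]
            rw [Khovanskii.ePD_map, heval]
          rw [hJ, ← RingHom.map_det, map_ne_zero]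
          exact hdet }
    have hmem : x ⟨0, hn⟩ ∈ ecl C :=
      Khovanskii.mem_ecl_iff.mpr ⟨Fin n, inferInstance, inferInstance, x, f, hsol, ⟨0, hn⟩, rfl⟩
    have hC' : ecl C = C := hC
    rw [hC'] at hmem
    have h0 : ((Submodule.span ℚ C).mkQ ∘ x) ⟨0, hn⟩ = 0 := by
      simp only [Function.comp_apply, Submodule.mkQ_apply, Submodule.Quotient.mk_eq_zero]
      exact Submodule.subset_span hmem
    exact hx.ne_zero ⟨0, hn⟩ h0
  · /- (b) a non-zero E-derivation `D` of `L` over `F` -/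
    -- `D` as a `ℤ`-derivation, its constants `CD`
    set Dz : Derivation ℤ L L := D.restrictScalars ℤ with hDz
    set D1 : Fin 1 → Derivation ℤ L L := fun _ => Dz with hD1
    set CD : Subring L := Transcendental.constantSubring D1 with hCD
    have hmemCD : ∀ a : L, a ∈ CD ↔ D a = 0 := fun a => by
      simp only [hCD, hD1, hDz, Transcendental.mem_constantSubring, forall_const]
      exact Iff.rfl
    have hFCD : ∀ c : F, algebraMap F L c ∈ CD := fun c => (hmemCD _).mpr (D.map_algebraMap c)
    -- the elements of `L` killed by `D`, as a `ℚ`-subspace `N` of `K`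
    set N : Submodule ℚ K := Submodule.restrictScalars ℚ
      ((LinearMap.ker (D : L →ₗ[F] L)).map (IsScalarTower.toAlgHom F L K).toLinearMap) with hN
    have hmemN : ∀ a : K, a ∈ N ↔ ∃ l : L, D l = 0 ∧ (l : K) = a := fun a => by
      simp only [hN, Submodule.restrictScalars_mem, Submodule.mem_map, LinearMap.mem_ker]
      constructor
      · rintro ⟨l, hl, rfl⟩; exact ⟨l, hl, rfl⟩
      · rintro ⟨l, hl, rfl⟩; exact ⟨l, hl, rfl⟩
    -- the dependence space `V = {q ∈ ℚⁿ | q·x̄ ∈ N}` and the splitting `n = n' + m`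
    set T : (Fin n → ℚ) →ₗ[ℚ] K := Fintype.linearCombination ℚ x with hT
    have hTapply : ∀ v : Fin n → ℚ, T v = ∑ i, v i • x i := fun v =>
      Fintype.linearCombination_apply ℚ x v
    set V : Submodule ℚ (Fin n → ℚ) := N.comap T with hV
    set T' : (Fin n → ℚ) →ₗ[ℚ] K ⧸ N := N.mkQ ∘ₗ T with hT'
    have hker : LinearMap.ker T' = V := by rw [hT', LinearMap.ker_comp, Submodule.ker_mkQ]
    obtain ⟨κ, a, ha, hspan, hli⟩ := exists_linearIndependent' ℚ ((Submodule.mkQ N) ∘ x)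
    haveI : Fintype κ := Fintype.ofInjective a ha
    set n' := Fintype.card κ with hn'
    set e := Fintype.equivFin κ with he
    have hrange : Module.finrank ℚ (LinearMap.range T') = n' := by
      have h1 : LinearMap.range T' = Submodule.span ℚ (Set.range (N.mkQ ∘ x)) := by
        rw [hT', LinearMap.range_comp, hT, Fintype.range_linearCombination, Submodule.map_span,
          ← Set.range_comp]
      rw [h1, ← hspan, finrank_span_eq_card hli]
    set m := Module.finrank ℚ V with hm
    have hnm : n' + m = n := by
      have := LinearMap.finrank_range_add_finrank_ker T'
      rwa [hrange, hker, Module.finrank_fin_fun] at this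
    have hmn : m < n := by
      by_contra hmn'
      have hmn2 : m = n := le_antisymm (by omega) (not_lt.mp hmn')
      have hVtop : V = ⊤ :=
        Submodule.eq_top_of_finrank_eq (by rw [← hm, hmn2, Module.finrank_fin_fun])
      have hmemV : (Pi.single j₀ (1 : ℚ) : Fin n → ℚ) ∈ V := hVtop ▸ Submodule.mem_top
      rw [hV, Submodule.mem_comap, hT, Fintype.linearCombination_apply_single, one_smul] at hmemV
      obtain ⟨l, hl0, hl⟩ := (hmemN _).mp hmemV
      have hlx : l = xL j₀ := Subtype.ext hl
      rw [hlx] at hl0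
      exact hj₀ hl0
    -- Ax's theorem (any universe) for a maximal sub-tuple `x̄'` of `x̄` independent modulo `N`
    set x' : Fin n' → L := fun i => xL (a (e.symm i)) with hx'
    set y' : Fin n' → L := fun i => yL (a (e.symm i)) with hy'
    have hind : Transcendental.IsQLinearIndependentMod D1 x' := by
      intro q hq
      have hD0 : D (∑ i, (q i : L) * x' i) = 0 := (hmemCD _).mp hq
      have hNmem : (∑ i, ((q i : ℚ)) • x (a (e.symm i))) ∈ N := by
        refine (hmemN _).mpr ⟨_, hD0, ?_⟩
        rw [show (∑ i, ((q i : ℚ)) • x (a (e.symm i))) = ∑ i, (q i : K) * x (a (e.symm i)) from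
          Finset.sum_congr rfl fun i _ => by rw [Rat.smul_def, Rat.cast_intCast]]
        push_cast
        simp only [hx', hxL]
      have h0 : ∑ i, ((q i : ℤ) : ℚ) • ((N.mkQ ∘ x ∘ a) ∘ e.symm) i = 0 := by
        have h1 : N.mkQ (∑ i, ((q i : ℚ)) • x (a (e.symm i))) = 0 :=
          (Submodule.Quotient.mk_eq_zero N).mpr hNmem
        rw [map_sum] at h1
        simpa only [map_smul, Function.comp_apply] using h1
      have hli' : LinearIndependent ℚ ((N.mkQ ∘ x ∘ a) ∘ e.symm) := hli.comp e.symm e.symm.injective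
      have h2 := Fintype.linearIndependent_iff.mp hli' _ h0
      funext i
      exact_mod_cast h2 i
    have hAxL' := Ax1971.add_rank_le_trdeg D1 x' y' (fun i => hy0 _)
      (fun _ i => hDE (a (e.symm i))) hind
    have hAxL := le_trans (Nat.cast_le.mpr (Nat.le_add_right n' _)) hAxL'
    letI algCD : Algebra CD L := Algebra.ofSubsemiring CD
    have h1 : (n' : Cardinal) ≤ Algebra.trdeg CD L :=
      hAxL.trans (trdeg_le_of_injective (Subalgebra.val _) Subtype.val_injective)
    -- an integral basis of `V` and the tuple `z̄`
    let bV := Module.finBasis ℚ V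
    have hint : ∀ k : Fin m, ∃ d : ℕ, d ≠ 0 ∧ ∃ w : Fin n → ℤ,
        ∀ i, (d : ℚ) * ((bV k : V) : Fin n → ℚ) i = w i := fun k => exists_nat_mul_eq_intCast _
    choose d hd w hw using hint
    have huV : ∀ k, (fun i => (w k i : ℚ)) ∈ V := fun k => by
      have : (fun i => (w k i : ℚ)) = (d k : ℚ) • ((bV k : V) : Fin n → ℚ) := by
        funext i; rw [Pi.smul_apply, smul_eq_mul, hw]
      rw [this]
      exact V.smul_mem _ (bV k).2
    have hli_u : LinearIndependent ℚ (fun k => fun i => (w k i : ℚ)) := by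
      have hb : LinearIndependent ℚ (fun k => ((bV k : V) : Fin n → ℚ)) :=
        bV.linearIndependent.map' V.subtype (Submodule.ker_subtype V)
      have hb2 := hb.units_smul fun k => Units.mk0 (d k : ℚ) (Nat.cast_ne_zero.mpr (hd k))
      convert hb2 using 1
      funext k i
      change (w k i : ℚ) = ((Units.mk0 (d k : ℚ) (Nat.cast_ne_zero.mpr (hd k))) •
        ((bV k : V) : Fin n → ℚ)) i
      rw [Units.smul_def, Units.val_mk0, Pi.smul_apply, smul_eq_mul, hw]
    set z : Fin m → K := fun k => ∑ i, (w k i : K) * x i with hz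
    -- `z̄` is independent modulo `C`
    have hzind : LinearIndependent ℚ ((Submodule.span ℚ C).mkQ ∘ z) := by
      rw [Fintype.linearIndependent_iff]
      intro c hc
      have hc1 : ∑ i, (∑ k, c k * (w k i : ℚ)) • ((Submodule.span ℚ C).mkQ ∘ x) i = 0 := by
        rw [← hc]
        simp only [Function.comp_apply, hz, map_sum, Finset.smul_sum, Finset.sum_smul, mul_smul]
        rw [Finset.sum_comm]
        refine Finset.sum_congr rfl fun k _ => Finset.sum_congr rfl fun i _ => ?_
        rw [← map_smul, ← map_smul, ← map_smul, Rat.smul_def (w k i : ℚ), Rat.cast_intCast]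
      have hc2 := Fintype.linearIndependent_iff.mp hx _ hc1
      have hc3 : ∑ k, c k • (fun i => (w k i : ℚ)) = 0 := by
        funext i
        rw [Finset.sum_apply, Pi.zero_apply]
        simpa only [Pi.smul_apply, smul_eq_mul] using hc2 i
      exact Fintype.linearIndependent_iff.mp hli_u c hc3
    -- `z_k ∈ L` and `e^{z_k} ∈ L` are killed by `D`
    set zLk : Fin m → L := fun k => ∑ i, (w k i : L) * xL i with hzLk
    have hzcoe : ∀ k, ((zLk k : L) : K) = z k := fun k => by
      simp only [hzLk, hz, hxL]
      push_cast
      rfl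
    have hDz0 : ∀ k, D (zLk k) = 0 := fun k => by
      obtain ⟨l, hl0, hl⟩ := (hmemN _).mp (Submodule.mem_comap.mp (huV k))
      have hTz : T (fun i => (w k i : ℚ)) = z k := by
        rw [hTapply, hz]
        exact Finset.sum_congr rfl fun i _ => by rw [Rat.smul_def, Rat.cast_intCast]
      have hl' : l = zLk k := Subtype.ext (by rw [hl, hTz, hzcoe])
      rw [← hl']
      exact hl0
    set ezLk : Fin m → L := fun k => ∏ i, yL i ^ w k i with hezLk
    have hezcoe : ∀ k, ((ezLk k : L) : K) = Literature.ModelTheory.ExponentialFields.ExponentialRing.exp (z k) := fun k => by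
      rw [hz]
      dsimp only
      rw [exp_sum_intCast_mul]
      simp only [hezLk, hyL]
      push_cast
      rfl
    have hDez0 : ∀ k, D (ezLk k) = 0 := fun k => by
      simp only [hezLk]
      rw [derivation_prod_zpow_of_exp D xL yL hy0 hDE (w k)]
      have : D (∑ i, (w k i : L) * xL i) = 0 := hDz0 k
      rw [this, mul_zero]
    -- induction hypothesis for `z̄`
    have hIH : (m : Cardinal) ≤ relTrdeg C z := ih m hmn z hzind
    set Sz : Set K := Set.range z ∪ Set.range (Literature.ModelTheory.ExponentialFields.ExponentialRing.exp ∘ z) with hSz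
    set Nz : IntermediateField F K := IntermediateField.adjoin F Sz with hNz
    change (m : Cardinal) ≤ Algebra.trdeg F Nz at hIH
    have hle : Nz ≤ L := by
      rw [hNz, IntermediateField.adjoin_le_iff]
      rintro t (⟨k, rfl⟩ | ⟨k, rfl⟩)
      · rw [← hzcoe]; exact (zLk k).2
      · simp only [Function.comp_apply]; rw [← hezcoe]; exact (ezLk k).2
    have hιE : ∀ (t : K) (ht : t ∈ Nz), (⟨t, hle ht⟩ : L) ∈ CD := by
      intro t ht
      rw [hmemCD]
      induction ht using IntermediateField.adjoin_induction with
      | mem t ht =>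
        rcases ht with ⟨k, rfl⟩ | ⟨k, rfl⟩
        · have h' : (⟨z k, hle (IntermediateField.subset_adjoin F Sz (Or.inl ⟨k, rfl⟩))⟩ : L) =
              zLk k := Subtype.ext (hzcoe k).symm
          rw [h']; exact hDz0 k
        · have h' : (⟨(Literature.ModelTheory.ExponentialFields.ExponentialRing.exp ∘ z) k,
              hle (IntermediateField.subset_adjoin F Sz (Or.inr ⟨k, rfl⟩))⟩ : L) = ezLk k :=
            Subtype.ext (hezcoe k).symm
          rw [h']; exact hDez0 k
      | algebraMap c => exact D.map_algebraMap c
      | add s t hs ht ihs iht =>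
        have h' : (⟨s + t, hle (add_mem hs ht)⟩ : L) = ⟨s, hle hs⟩ + ⟨t, hle ht⟩ := rfl
        rw [h', map_add, ihs, iht, add_zero]
      | inv s hs ihs =>
        have h' : (⟨s⁻¹, hle (inv_mem hs)⟩ : L) = (⟨s, hle hs⟩)⁻¹ := rfl
        rw [h', Derivation.leibniz_inv, ihs, smul_zero]
      | mul s t hs ht ihs iht =>
        have h' : (⟨s * t, hle (mul_mem hs ht)⟩ : L) = ⟨s, hle hs⟩ * ⟨t, hle ht⟩ := rfl
        rw [h', Derivation.leibniz, ihs, iht, smul_zero, smul_zero, add_zero]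
    -- assembling: `n = m + n' ≤ trdeg_F Nz + trdeg_CD L ≤ trdeg_F L`
    have htower := trdeg_add_le_of_le_subring L Nz hle CD hFCD hιE
    calc (n : Cardinal) = (m : Cardinal) + (n' : Cardinal) := by
          rw [← hnm, Nat.cast_add, add_comm]
      _ ≤ Algebra.trdeg F Nz + Algebra.trdeg CD L := add_le_add hIH h1
      _ ≤ Algebra.trdeg F L := htower

end Main

/-! ### The discharge -/

section Discharge

variable (K : Type u) [Field K] [CharZero K] [Literature.ModelTheory.ExponentialFields.ExponentialRing K]

/-- **Kirby 2010, Thm. 1.2 HOLDS** (form `δ(x̄/C) ≥ 0`): the named fact `Kirby2010_weakSchanuel K`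
of `EclPregeometry.lean` — for every `ecl`-closed `C ⊆ K` and every tuple `x̄ ∈ Kⁿ`,
`ldim_ℚ(x̄/C) ≤ td(x̄, exp x̄/C)` — holds for every exponential field `K` of characteristic zero, in
every universe (the instance `K : Type` was `Kirby2010_weakSchanuel_holds_type0`). Proof: reduce an
arbitrary tuple to a maximal sub-tuple `x̄'` independent modulo `⟨C⟩_ℚ` (`ldim_ℚ(x̄/C)` elements,
and `td(x̄', exp x̄'/C) ≤ td(x̄, exp x̄/C)` as for `relTrdeg_comp_le` of
`KirbyWeakSchanuelProofs.lean`) and apply `card_le_relTrdeg_of_isEclClosed` (Kirby's induction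
through the Khovanskii dichotomy and Ax 1971 Thm. 3, `Ax1971.add_rank_le_trdeg`, itself from
Rosenlicht 1976 Prop. 4 proved by residues). [cite: Kirby2010, Thm. 1.2] -/
theorem Kirby2010_weakSchanuel_holds : Kirby2010_weakSchanuel K := by
  intro C hC n x
  classical
  obtain ⟨κ, a, ha, hspan, hli⟩ := exists_linearIndependent' ℚ ((Submodule.span ℚ C).mkQ ∘ x)
  haveI : Fintype κ := Fintype.ofInjective a ha
  set e := Fintype.equivFin κ
  have hli' : LinearIndependent ℚ ((Submodule.span ℚ C).mkQ ∘ ((x ∘ a) ∘ e.symm)) := by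
    have : (Submodule.span ℚ C).mkQ ∘ ((x ∘ a) ∘ e.symm) =
        (((Submodule.span ℚ C).mkQ ∘ x) ∘ a) ∘ e.symm := rfl
    rw [this]
    exact (linearIndependent_equiv e.symm).mpr hli
  have hdim : relLinDim C x = Fintype.card κ := by
    unfold relLinDim
    rw [← hspan]
    exact finrank_span_eq_card hli
  -- `td(x̄ ∘ a, exp(x̄ ∘ a)/C) ≤ td(x̄, exp x̄/C)`: the field generated over `ℚ(C)` by the sub-tuple
  -- and its exponentials is contained in the one generated by `x̄, exp x̄` (this is
  -- `relTrdeg_comp_le` of `KirbyWeakSchanuelProofs.lean`, stated there for fields in `Type`).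
  have hmono : relTrdeg C ((x ∘ a) ∘ e.symm) ≤ relTrdeg C x := by
    unfold relTrdeg
    set L := IntermediateField.adjoin ℚ C
    have hsub : Set.range ((x ∘ a) ∘ e.symm) ∪
        Set.range (Literature.ModelTheory.ExponentialFields.ExponentialRing.exp ∘ ((x ∘ a) ∘ e.symm)) ⊆
        Set.range x ∪ Set.range (Literature.ModelTheory.ExponentialFields.ExponentialRing.exp ∘ x) := by
      apply Set.union_subset_union
      · rintro _ ⟨i, rfl⟩; exact ⟨a (e.symm i), rfl⟩
      · rintro _ ⟨i, rfl⟩; exact ⟨a (e.symm i), rfl⟩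
    exact trdeg_le_of_injective
      (IntermediateField.inclusion (IntermediateField.adjoin.mono L _ _ hsub))
      (IntermediateField.inclusion_injective _)
  rw [hdim]
  exact (card_le_relTrdeg_of_isEclClosed hC _ _ hli').trans hmono

variable {K}

/-- The weak Schanuel property over `ecl ∅` (which is `ecl`-closed: `isEclClosed_ecl`, Kirby Lemma
3.3 proved in `EclClosureOperatorProofs.lean`), unconditionally and in every universe: for every
`x̄ ∈ Kⁿ`, `ldim_ℚ(x̄/ecl ∅) ≤ td(x̄, exp x̄/ecl ∅)` — the form used on route `Schanuel/EclCore`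
(cf. `Kirby2010_weakSchanuel.ecl_empty`, which took both the fact and idempotence as hypotheses).
[cite: Kirby2010, Thm. 1.2] -/
theorem relLinDim_ecl_empty_le_relTrdeg {n : ℕ} (x : Fin n → K) :
    (relLinDim (ecl (∅ : Set K)) x : Cardinal) ≤ relTrdeg (ecl (∅ : Set K)) x :=
  Kirby2010_weakSchanuel_holds K _ (isEclClosed_ecl (∅ : Set K)) n x

end Discharge

end Literature.NumberTheory.Transcendental

end
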